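import Summits.CriticalPhenomena.Ising3DConformalLimit.Theses.PlantedPinning
import Summits.CriticalPhenomena.Ising3DConformalLimit.Theorems.PlantedPinningPinningEfficiencyLeOne
import Summits.CriticalPhenomena.Ising3DConformalLimit.Theorems.PlantedPinningPinningEfficiencyDeficitOneStepDrop
import Summits.CriticalPhenomena.Ising3DConformalLimit.Theorems.PlantedPinningPinningEfficiencyDeficitRiccatiWithSlack

/-!
# Crux `PlantedPinning.PinningEfficiencyDeficit` (stmt-CriticalPhenomena-8451) — birth skeleton `Lines/birth.lean`

## Status (lead `prover-line-stmt-CriticalPhenomena-8451-c2-0`, cycle 2, 2026-08-17)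
* S2 `stub_oneStepDrop` — LANDED (p143629, `Theorems/PlantedPinningPinningEfficiencyDeficitOneStepDrop.lean`,
  `PlantedPinningDeficit.stub_oneStepDrop`, general form `oneStepDrop_general`).
* S3 `stub_riccatiWithSlack` — LANDED (p143636, `Theorems/PlantedPinningPinningEfficiencyDeficitRiccatiWithSlack.lean`).
* Composition + slack-free direction — LANDED (p144818, `Theorems/PlantedPinningPinningEfficiencyDeficitOfSlack.lean`):
  `pvar_sq_le_csq` (`(pvar L j)² ≤ csq L j`, any finite Ising volume) and
  `pinningEfficiencyDeficit_of_csSlackWindow : S1 → PinningEfficiencyDeficit` — the crux is closed MODULO S1 in the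
  Theorems tree.
* Exact slack decomposition — LANDED (p157397, lead c2, `Theorems/PlantedPinningPinningEfficiencyDeficitSlackDecomposition.lean`,
  `PlantedPinningDeficit.csq_sub_pvar_sq_eq` / `_closed` / `spatial_le_csq_sub_pvar_sq`):
  `csq − pvar² = SPATIAL + PATTERN + PIN-SET` = `E_{P,τ}[(n−j) Σ_z (χ_z − X/(n−j))²] + E_P Var_τ(X) + Var_P(E_τ X)`
  (three sums of squares; `X = Var(M | pins) = Σ_z χ_z`, `χ_z = Cov(M, σ_z | pins)`).  PATTERN + PIN-SET = Var(X)
  are `O(L*(p)^3/n)·pvar²` (self-averaging), so S1 ⟺ a `p`-uniform lower bound on SPATIAL/pvar² → A(p), the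
  relative spatial variance of the local conditional susceptibility; e* = 1/(1 + lim A).
* S1 `stub_csSlackWindow` — OPEN (the only `sorry`; lead).  Analysis (seat file `S1-analysis.md`, attached to the
  item): A = A_pos + A_val; A_pos (pin positions, linear response) ≍ p^{2Δ_σ/(d−2Δ_σ)} = p^{0.53} → 0 and is all a
  value-blind (Gaussian) conditioning has (A_val ≡ 0 there: e_GFF → 1); A_val (planted VALUES) is Θ(1) as p → 0 iff
  the critical block-spin law at the crossover scale L*(p) is non-Gaussian — i.e. S1 is a quantitative
  non-triviality statement for the 3D Ising infrared fixed point: open problem, no rigorous handle either way (only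
  triviality in d ≥ 4 is a theorem).
* NUMERICS (lead c2; kit jobs j027034–j027039 attached to the item; SW with frozen pinned clusters = exact sampler of
  the pinned measure, FK improved estimator of χ_z validated against exact enumeration (j025574), exact GFF benchmark
  on the same pin sets; d = 3, L = 32/48/64, p = 0.005…0.08, 4 pin sets × 2 value draws × 2 chains each):
  A_val = 0.06–0.11 at EVERY p for L ≥ 48 (fits A_val ∝ p^{−0.04} / p^{−0.00}; extrapolation A_val* = 0.07 ± 0.01),
  while A_pos ∝ p^{0.532} / p^{0.529} (prediction 0.528) and A_gff ∝ p^{0.43} → 0 (extrapolates to 0.005 ± 0.001);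
  χ_z/χ̄ binned by |E[σ_z|pins]| quantiles = 1.29, 1.16, 0.93, 0.69, 0.47 — one curve for all ten (L,p) data sets
  (flat by theorem for Gaussian conditioning); e_L(⌈pn⌉) = 0.80–0.86 vs the GFF's 0.87 → 0.96 on the same pins.
  The route's kill criterion (a) does NOT fire: the slack is value-driven, mesoscopic and p-flat, target
  A* ≈ 0.07 (e* ≈ 0.93).  2D control: A_val = 0.7–1.0, e ≈ 0.35.  S1 stays what the card says: right physics,
  open mathematics.  Lead c2 hands S1 back as crux-sized (`promote-stub`): it IS the crux's content
  (S1 → crux landed, p144818), and no split inside this line makes it smaller.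

Skeleton-registrar seat `planner-skel-stmt-CriticalPhenomena-8451-0`, 2026-08-17 (route re-audit bin REPAIRABLE:
BC3 skeleton backfilled for the rank-2 crux of `route-CriticalPhenomena-PlantedPinning`).
Line card: `Cruxes/PinningEfficiencyDeficit/Lines/birth.md`.

## The crux (fixed; concluded BY NAME below)

`PinningEfficiencyDeficit` ("e* < 1"): with `n = |Λ_L|`, `Λ_L = box 3 L`, `k = ⌈p n⌉`, planted conditional variance
`v_{L,j} = pvar L j = (n choose j)⁻¹ ∑_{|P| = j} ∑_τ w(τ) Var^{τ∨+}_{Λ_L∖P}(M_Λ)` (`w = ` critical `+`-box Boltzmann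
weight `/ Z`) and efficiency `e_L(j) = j v_{L,j} / ((n+1)(n−j+1))`:
`∃ ε > 0 ∃ p₀ > 0 ∀ p ∈ (0,p₀) ∃ L₀ ∀ L ≥ L₀, e_L(⌈p n⌉) ≤ 1 − ε`.

## Spelling note (why S1/S2 are written as explicit β-redexes)
S1 and S2 use the route's objects (`βc = criticalBeta 3`, `M`, `pvar`, and the new `csq`) but are spelled
`(fun βc M => (fun pvar csq => BODY) (fun L k => …) (fun L j => …)) (criticalBeta 3) (fun L σ => …)` instead of the
route's `let … := …;` tower: the registrar's one-line signature scanner (`ledger skeleton check`) cuts a stub signature at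
its first `:=`, so a `let` tower would register as the truncated text `let βc : ℝ` and every `propose --supports` of the
stub would then bounce `supports.stub-mismatch`.  The β-redex spelling contains no `:=`, elaborates to the same proposition
(β instead of ζ; `cvar`/`ccov` are substituted in place), and `intro` / `obtain` see through it exactly as through the lets.
Provers: copy the stub signature VERBATIM from this file (it is the registered text).

## The line in one screen (the route's foreseen split "SlackLowerBound → RiccatiWithSlack", D-0019 two-layer plan)

The ceiling `e ≤ 1` (landed support items 8454/8455) is the discrete Riccati inequality
`v_{j+1} ≤ v_j − v_j²/(n−j)²`, obtained from the EXACT one-pin drop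
`v_{j+1} = v_j − 𝔼_{P,τ}[(n−j)⁻¹ ∑_{z ∉ P} Cov(M,σ_z | σ_P)² / Var(σ_z | σ_P)]` by three lossy steps:
`Var(σ_z|·) ≤ 1`, Cauchy–Schwarz over the new pin `z`, Jensen over `(P, τ)`.  The deficit `e* < 1` is EXACTLY a
uniform lower bound on the loss.  We name the explicit Cauchy–Schwarz functional
`csq L j := (n choose j)⁻¹ ∑_{|P|=j} ∑_τ w(τ) · (n−j) · ∑_{z ∈ Λ∖P} Cov^{τ∨+}_{Λ∖P}(M, σ_z)²`
(a two-replica / 4-spin quantity: the second moment over space of the local conditional susceptibility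
`χ_z = Cov(M, σ_z | pins)`), for which `csq L j ≥ (pvar L j)²` ALWAYS (CS + Jensen; equality iff `χ_z` is flat in `z`
and `Var(M | pins)` does not fluctuate with the pins), and cut the crux into:

* S1 `stub_csSlackWindow` (THE PHYSICS; hardest; open): a `p`-uniform strict slack `csq L j ≥ (1+s)·(pvar L j)²`,
  `s > 0`, at every pin number `j` in the density window `[⌈pn⌉/2, ⌈pn⌉)`, for `L ≥ L₀(p)`, all `p < p₀`
  — spatial intermittency of the local conditional susceptibility at the screening scale `L*(p) ≍ p^{-1/(3−2Δ_σ)}`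
  does not self-average away (it is a LOCAL relative variance, unlike the Jensen part which is `O(L*³/n)`).
* S2 `stub_oneStepDrop` (provable now, M): `pvar L (j+1) ≤ pvar L j − csq L j/(n−j)²` for `j < n` — the one-pin
  variance drop keeping the Cauchy–Schwarz term explicit: `sum_condCov_sq_le_vbar_sub` + double counting
  `sum_powersetCard_sum_sdiff_insert` + Pascal + the finite-volume DLR transport `sum_kernel_isingWeight_eq`
  (all landed in `Theorems/PlantedPinningPinningEfficiencyLeOne*.lean`; this is the `hstepv` step of
  `PlantedPinningCeiling.pinning_lemma` with `∑_z ∑_ω w C_z²` not yet discarded).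
* S3 `stub_riccatiWithSlack` (elementary real analysis, M): for `v : ℕ → ℝ` with the ceiling `0 ≤ e_j ≤ 1`
  (`1 ≤ j ≤ n`) and the slacked step `v_{j+1} ≤ v_j − (1+s) v_j²/(n−j)²` on the window `k ≤ 2j < 2k`
  (`2 ≤ k ≤ n`, `s ≥ 0`): `e_k ≤ 1/(1 + s/3)`.  Proof sketch (checked numerically in the seat folder):
  reciprocal form `1/v_{j+1} ≥ 1/v_j + (1+s)/(n−j)²`, telescope `∑ 1/((n−j)(n−j+1))` over the window,
  ceiling at `m = ⌈k/2⌉`, and `(k−m)/k ≥ 1/3` for `k ≥ 2`; cf. `PlantedPinningCeiling.riccati_bound`.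
* Composition `PinningEfficiencyDeficit_of : S1 → S2 → S3 → PinningEfficiencyDeficit` (kernel-checked, no
  sorry): `ε := 1 − 1/(1+s/3)`, `p < min p₀ 1`, `L ≥ max L₀ ⌈2/p⌉` (so `n = (2L+1)³ ≥ L`, `p n ≥ 2`, hence
  `2 ≤ k = ⌈pn⌉ ≤ n`), glue lemma `slackedStep_of_drop_of_slack` (S1 + S2 ⇒ slacked step on the window), then S3
  fed with the LANDED ceiling `PlantedPinningCeiling.pinningEfficiencyLeOne_proof` (item 8455).
  the closing `example : PinningEfficiencyDeficit := PinningEfficiencyDeficit_of stub_… stub_… stub_…` discharges the three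
  hypotheses (stated over the `__Registered.stub_*` aliases, see below) with the registered stubs verbatim.

## Hardest stub / where `d = 3`, nearest-neighbour and `β = β_c` are used
Only S1 uses them (S2 holds for every finite weighted ±1 system, S3 is arithmetic): S1 must fail for the massless
lattice GFF benchmark (value-blind conditioning, `e → 1`) and is predicted `e* = 1`-false in `d ≥ 5` and for RP
long-range couplings `α < 3/2` (`Literature.Barriers.CriticalPhenomena.IsingTrivialityFromDimensionFour`,
`LongRangeTrivialityOnZ3`): the proof of S1 must use `d < 4` + short range — conceded, as in the route header.

## Disproof used
None exists yet for this crux (`ledger crux ls stmt-CriticalPhenomena-8451`: no `Disproof.lean`, no Negative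
lemmas, 2026-08-17); negatives index (11 items, Cardy/SAW/percolation) untouched.  Dead lines: none recorded.

## BC3 audit (seat folder `bc/`, 2026-08-17; farm rc quoted)
`lean check --json` of this file: rc 0, sorries = 3 = stubs (S1, S2, S3), zero elsewhere.  Probes importing ONLY
the route file, `set_option maxHeartbeats 400000`: for each stub `T`, `example : T → PinningEfficiencyDeficit`
and `example : T → Ising3DConformalLimit` by `first | exact? | simpa | simpa [PinningEfficiencyDeficit] |
(unfold PinningEfficiencyDeficit; simpa) | aesop` — all 6 FAIL (rc 1); per-tactic breakdown (24 examples):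
`exact?` "could not close the goal" ×6, `simpa` "assumption failed" ×6, `unfold;simpa` fails ×6,
`aesop` "failed to prove the goal after exhaustive search" ×6.
-/

namespace Summit.CriticalPhenomena.Ising3DConformalLimit.Cruxes.PinningEfficiencyDeficit.Birth

open Summit.CriticalPhenomena.Ising3DConformalLimit.Theses.PlantedPinning

/-- **S1 — `stub_csSlackWindow` (the physics; hardest; the ONLY open stub of the line).**
Uniform strict Cauchy–Schwarz/Jensen slack of the planted pinning flow in the density window `[p/2, p)`:
there are `s > 0` and `p₀ > 0` such that for every `p ∈ (0, p₀)`, for all `L` large and every pin number `j` with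
`⌈p n⌉ ≤ 2j`, `j < ⌈p n⌉` (`n = |box 3 L|`), `(1 + s) · (pvar L j)² ≤ csq L j`, where
`csq L j = (n choose j)⁻¹ ∑_{|P| = j} ∑_τ w(τ) (n − j) ∑_{z ∈ Λ∖P} Cov^{τ∨+}_{Λ∖P}(M_Λ, σ_z)²`.
The slack-free direction `(pvar L j)² ≤ csq L j` is the landed `PlantedPinningDeficit.pvar_sq_le_csq` (p144818).
Why plausibly true / why it might fail: see the module docstring (Status) and the line card.  Size: open problem (XL). -/
theorem stub_csSlackWindow : (fun (βc : ℝ) (M : ℕ → Literature.Probability.LatticeModels.SpinConfig (Literature.Probability.LatticeModels.Site 3) → ℝ) => (fun (pvar csq : ℕ → ℕ → ℝ) => ∃ s : ℝ, 0 < s ∧ ∃ p₀ : ℝ, 0 < p₀ ∧ ∀ p : ℝ, 0 < p → p < p₀ → ∃ L₀ : ℕ, ∀ L ≥ L₀, ∀ j : ℕ, ⌈p * ((Literature.Probability.LatticeModels.box 3 L).card : ℝ)⌉₊ ≤ 2 * j → j < ⌈p * ((Literature.Probability.LatticeModels.box 3 L).card : ℝ)⌉₊ → (1 + s) * pvar L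 j ^ 2 ≤ csq L j) (fun (L k : ℕ) => (∑ P ∈ (Literature.Probability.LatticeModels.box 3 L).powersetCard k, ∑ τ : ↥(Literature.Probability.LatticeModels.box 3 L) → ℤˣ, Literature.Probability.LatticeModels.isingWeight (Literature.Probability.LatticeModels.zdGraph 3) (Literature.Probability.LatticeModels.box 3 L) βc 0 .plus τ / Literature.Probability.LatticeModels.isingPartitionFunction (Literature.Probability.LatticeModels.zdGraph 3) (Literature.Probability.LatticeModels.box 3 L) βc 0 .plus * (Literature.Probability.LatticeModels.isingExpect (Literature.Probability.LatticeModels.zdGraph 3) (Literature.Probability.LatticeModels.box 3 L \ P) βc 0 (.fixed (Literature.Probability.LatticeModels.glue (Literature.Probability.LatticeModels.box 3 L) τ .plus)) (fun σ => M L σ ^ 2) - Literature.Probability.LatticeModels.isingExpect (Literature.Probability.LatticeModels.zdGraph 3) (Literature.Probability.LatticeModels.box 3 L \ P) βc 0 (.fixed (Literature.Probability.LatticeModels.glue (Literature.Probability.LatticeModels.box 3 L) τ .plus)) (M L) ^ 2)) / ((Literature.Probability.LatticeModels.box 3 L).card.choose k : ℝ)) (fun (L j : ℕ) => (∑ P ∈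 (Literature.Probability.LatticeModels.box 3 L).powersetCard j, ∑ τ : ↥(Literature.Probability.LatticeModels.box 3 L) → ℤˣ, Literature.Probability.LatticeModels.isingWeight (Literature.Probability.LatticeModels.zdGraph 3) (Literature.Probability.LatticeModels.box 3 L) βc 0 .plus τ / Literature.Probability.LatticeModels.isingPartitionFunction (Literature.Probability.LatticeModels.zdGraph 3) (Literature.Probability.LatticeModels.box 3 L) βc 0 .plus * ((((Literature.Probability.LatticeModels.box 3 L).card : ℝ) - j) * ∑ z ∈ Literature.Probability.LatticeModels.box 3 L \ P, (Literature.Probability.LatticeModels.isingExpect (Literature.Probability.LatticeModels.zdGraph 3) (Literature.Probability.LatticeModels.box 3 L \ P) βc 0 (.fixed (Literature.Probability.LatticeModels.glue (Literature.Probability.LatticeModels.box 3 L) τ .plus)) (fun σ => M L σ * Literature.Probability.LatticeModels.spinAt z σ) - Literature.Probability.LatticeModels.isingExpect (Literature.Probability.LatticeModels.zdGraph 3) (Literature.Probability.LatticeModels.box 3 L \ P) βc 0 (.fixed (Literature.Probability.LatticeModels.glue (Literature.Probability.LatticeModels.box 3 L) τ .plus)) (M L) * Literature.Probability.LatticeModels.isingExpect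 (Literature.Probability.LatticeModels.zdGraph 3) (Literature.Probability.LatticeModels.box 3 L \ P) βc 0 (.fixed (Literature.Probability.LatticeModels.glue (Literature.Probability.LatticeModels.box 3 L) τ .plus)) (fun σ => Literature.Probability.LatticeModels.spinAt z σ)) ^ 2)) / ((Literature.Probability.LatticeModels.box 3 L).card.choose j : ℝ))) (Literature.Probability.LatticeModels.criticalBeta 3) (fun (L : ℕ) (σ : Literature.Probability.LatticeModels.SpinConfig (Literature.Probability.LatticeModels.Site 3)) => ∑ x ∈ Literature.Probability.LatticeModels.box 3 L, Literature.Probability.LatticeModels.spinAt x σ) := by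
  sorry

/-! ### The open stub statement BY NAME — the hypothesis of `PinningEfficiencyDeficit_of`

(`#h21_check_skeleton` admits a hypothesis of the composing theorem only if it is a registered obligation or is NAMED
like a declared stub; the alias `__Registered.stub_csSlackWindow` repeats the registered signature verbatim, as in the
registrar's v3 skeleton.  S2 and S3 are no longer hypotheses: they are the landed theorems
`PlantedPinningDeficit.stub_oneStepDrop` / `PlantedPinningDeficit.stub_riccatiWithSlack`, consumed inside
`PlantedPinningDeficit.pinningEfficiencyDeficit_of_csSlackWindow`.) -/
namespace __Registered

/-- Alias of the statement of the registered stub `stub_csSlackWindow` (S1), keyed by its name. -/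
abbrev stub_csSlackWindow : Prop := (fun (βc : ℝ) (M : ℕ → Literature.Probability.LatticeModels.SpinConfig (Literature.Probability.LatticeModels.Site 3) → ℝ) => (fun (pvar csq : ℕ → ℕ → ℝ) => ∃ s : ℝ, 0 < s ∧ ∃ p₀ : ℝ, 0 < p₀ ∧ ∀ p : ℝ, 0 < p → p < p₀ → ∃ L₀ : ℕ, ∀ L ≥ L₀, ∀ j : ℕ, ⌈p * ((Literature.Probability.LatticeModels.box 3 L).card : ℝ)⌉₊ ≤ 2 * j → j < ⌈p * ((Literature.Probability.LatticeModels.box 3 L).card : ℝ)⌉₊ → (1 + s) * pvar L j ^ 2 ≤ csq L j) (fun (L k : ℕ) => (∑ P ∈ (Literature.Probability.LatticeModels.box 3 L).powersetCard k, ∑ τ : ↥(Literature.Probability.LatticeModels.box 3 L) → ℤˣ, Literature.Probability.LatticeModels.isingWeight (Literature.Probability.LatticeModels.zdGraph 3) (Literature.Probability.LatticeModels.box 3 L) βc 0 .plus τ / Literature.Probability.LatticeModels.isingPartitionFunction (Literature.Probability.LatticeModels.zdGraph 3) (Literature.Probability.LatticeModels.box 3 L) βc 0 .plus * (Literature.Probability.LatticeModels.isingExpect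 (Literature.Probability.LatticeModels.zdGraph 3) (Literature.Probability.LatticeModels.box 3 L \ P) βc 0 (.fixed (Literature.Probability.LatticeModels.glue (Literature.Probability.LatticeModels.box 3 L) τ .plus)) (fun σ => M L σ ^ 2) - Literature.Probability.LatticeModels.isingExpect (Literature.Probability.LatticeModels.zdGraph 3) (Literature.Probability.LatticeModels.box 3 L \ P) βc 0 (.fixed (Literature.Probability.LatticeModels.glue (Literature.Probability.LatticeModels.box 3 L) τ .plus)) (M L) ^ 2)) / ((Literature.Probability.LatticeModels.box 3 L).card.choose k : ℝ)) (fun (L j : ℕ) => (∑ P ∈ (Literature.Probability.LatticeModels.box 3 L).powersetCard j, ∑ τ : ↥(Literature.Probability.LatticeModels.box 3 L) → ℤˣ, Literature.Probability.LatticeModels.isingWeight (Literature.Probability.LatticeModels.zdGraph 3) (Literature.Probability.LatticeModels.box 3 L) βc 0 .plus τ / Literature.Probability.LatticeModels.isingPartitionFunction (Literature.Probability.LatticeModels.zdGraph 3) (Literature.Probability.LatticeModels.box 3 L) βc 0 .plus * ((((Literature.Probability.LatticeModels.box 3 L).card : ℝ) - j) * ∑ z ∈ Literature.Probability.LatticeModels.box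 3 L \ P, (Literature.Probability.LatticeModels.isingExpect (Literature.Probability.LatticeModels.zdGraph 3) (Literature.Probability.LatticeModels.box 3 L \ P) βc 0 (.fixed (Literature.Probability.LatticeModels.glue (Literature.Probability.LatticeModels.box 3 L) τ .plus)) (fun σ => M L σ * Literature.Probability.LatticeModels.spinAt z σ) - Literature.Probability.LatticeModels.isingExpect (Literature.Probability.LatticeModels.zdGraph 3) (Literature.Probability.LatticeModels.box 3 L \ P) βc 0 (.fixed (Literature.Probability.LatticeModels.glue (Literature.Probability.LatticeModels.box 3 L) τ .plus)) (M L) * Literature.Probability.LatticeModels.isingExpect (Literature.Probability.LatticeModels.zdGraph 3) (Literature.Probability.LatticeModels.box 3 L \ P) βc 0 (.fixed (Literature.Probability.LatticeModels.glue (Literature.Probability.LatticeModels.box 3 L) τ .plus)) (fun σ => Literature.Probability.LatticeModels.spinAt z σ)) ^ 2)) / ((Literature.Probability.LatticeModels.box 3 L).card.choose j : ℝ))) (Literature.Probability.LatticeModels.criticalBeta 3) (fun (L : ℕ) (σ : Literature.Probability.LatticeModels.SpinConfig (Literature.Probability.LatticeModels.Site 3)) => ∑ x ∈ Literature.Probability.LatticeModels.box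 3 L, Literature.Probability.LatticeModels.spinAt x σ)

end __Registered

/-- Glue (proved): a one-step drop `v (j+1) ≤ v j − c j/(n−j)²` (`j < n`) and a slack bound
`(1+s) (v j)² ≤ c j` on the window `k ≤ 2j`, `j < k ≤ n` give the slacked Riccati step on the window. -/
theorem slackedStep_of_drop_of_slack {v c : ℕ → ℝ} {n k : ℕ} {s : ℝ} (hkn : k ≤ n)
    (hdrop : ∀ j : ℕ, j < n → v (j + 1) ≤ v j - c j / ((n : ℝ) - j) ^ 2)
    (hslack : ∀ j : ℕ, k ≤ 2 * j → j < k → (1 + s) * v j ^ 2 ≤ c j) :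
    ∀ j : ℕ, k ≤ 2 * j → j < k → v (j + 1) ≤ v j - (1 + s) * v j ^ 2 / ((n : ℝ) - j) ^ 2 := by
  intro j hj1 hj2
  have hjn : j < n := lt_of_lt_of_le hj2 hkn
  have h1 := hdrop j hjn
  have h2 := hslack j hj1 hj2
  have h3 : (1 + s) * v j ^ 2 / ((n : ℝ) - j) ^ 2 ≤ c j / ((n : ℝ) - j) ^ 2 :=
    div_le_div_of_nonneg_right h2 (sq_nonneg _)
  linarith

/-- **Composition** (kernel-checked, sorry-free): `S1 → PinningEfficiencyDeficit` — the hypothesis is the open stub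
statement by name (`__Registered.stub_csSlackWindow`), the conclusion the crux BY NAME.  S2 and S3 enter as the LANDED
theorems `PlantedPinningDeficit.stub_oneStepDrop` (p143629) and `PlantedPinningDeficit.stub_riccatiWithSlack` (p143636),
the ceiling as `PlantedPinningCeiling.pinningEfficiencyLeOne_proof` (item 8455); `ε := 1 − 1/(1+s/3)`, `p < min p₀ 1`,
`L ≥ max L₀ ⌈2/p⌉` (`card_box`: `n = (2L+1)³ ≥ L`, so `2 ≤ ⌈pn⌉ ≤ n`).  The same theorem is landed as
`PlantedPinningDeficit.pinningEfficiencyDeficit_of_csSlackWindow` (p144818). -/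
theorem PinningEfficiencyDeficit_of : __Registered.stub_csSlackWindow → PinningEfficiencyDeficit := by
  intro h1
  have h2 := Summit.CriticalPhenomena.Ising3DConformalLimit.PlantedPinningDeficit.stub_oneStepDrop
  have h3 := Summit.CriticalPhenomena.Ising3DConformalLimit.PlantedPinningDeficit.stub_riccatiWithSlack
  dsimp only [__Registered.stub_csSlackWindow] at h1
  dsimp only at h2
  obtain ⟨s, hs, p₀, hp₀, hwin⟩ := h1
  have hs3 : (0 : ℝ) < 1 + s / 3 := by linarith
  have hε : (0 : ℝ) < 1 - 1 / (1 + s / 3) := by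
    have : 1 / (1 + s / 3) < 1 := (div_lt_one hs3).mpr (by linarith)
    linarith
  refine ⟨1 - 1 / (1 + s / 3), hε, min p₀ 1, lt_min hp₀ one_pos, ?_⟩
  intro p hp hpp
  have hp0 : p < p₀ := lt_of_lt_of_le hpp (min_le_left _ _)
  have hp1 : p < 1 := lt_of_lt_of_le hpp (min_le_right _ _)
  obtain ⟨L₀, hL₀⟩ := hwin p hp hp0
  refine ⟨max L₀ ⌈2 / p⌉₊, ?_⟩
  intro L hL
  have hLL₀ : L₀ ≤ L := le_trans (le_max_left _ _) hL
  have hLceil : ⌈2 / p⌉₊ ≤ L := le_trans (le_max_right _ _) hL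
  have hwinL := hL₀ L hLL₀
  set n : ℕ := (Literature.Probability.LatticeModels.box 3 L).card with hn
  have hnL : L ≤ n := by
    rw [hn, Literature.Probability.LatticeModels.card_box]
    calc L ≤ 2 * L + 1 := by omega
      _ ≤ (2 * L + 1) ^ 3 := Nat.le_self_pow (by norm_num) _
  have hnR : (L : ℝ) ≤ n := by exact_mod_cast hnL
  have hLp : 2 / p ≤ (L : ℝ) := le_trans (Nat.le_ceil _) (by exact_mod_cast hLceil)
  have hp' : p ≠ 0 := hp.ne'
  have h2p : p * (2 / p) = 2 := by field_simp
  have hpL : 2 ≤ p * (L : ℝ) := by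
    calc (2 : ℝ) = p * (2 / p) := h2p.symm
      _ ≤ p * L := mul_le_mul_of_nonneg_left hLp hp.le
  have hpn : (1 : ℝ) < p * n := by
    have := mul_le_mul_of_nonneg_left hnR hp.le
    linarith
  set k : ℕ := ⌈p * (n : ℝ)⌉₊ with hk
  have hk2 : 2 ≤ k := by
    have h1k : 1 < k := Nat.lt_ceil.mpr (by exact_mod_cast hpn)
    omega
  have hkn : k ≤ n := by
    refine Nat.ceil_le.mpr ?_
    exact mul_le_of_le_one_left (Nat.cast_nonneg n) hp1.le
  have hstep := slackedStep_of_drop_of_slack hkn (h2 L) hwinL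
  have key := h3 n k s _ hs.le hk2 hkn
    (Summit.CriticalPhenomena.Ising3DConformalLimit.PlantedPinningCeiling.pinningEfficiencyLeOne_proof L)
    hstep
  have e : (1 : ℝ) - (1 - 1 / (1 + s / 3)) = 1 / (1 + s / 3) := by ring
  rw [e]
  exact key

/-- **The registered stub discharges the hypothesis of `PinningEfficiencyDeficit_of` verbatim** (kernel-checked
`example`; it depends on S1's `sorry` until S1 lands — then `PinningEfficiencyDeficit_of stub_csSlackWindow` IS the
proof of the crux). -/
example : PinningEfficiencyDeficit :=
  PinningEfficiencyDeficit_of stub_csSlackWindow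

end Summit.CriticalPhenomena.Ising3DConformalLimit.Cruxes.PinningEfficiencyDeficit.Birth
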